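import Mathlib.GroupTheory.Complement
import Summits.MatrixMultiplication.OmegaCensus.BoxBadCommutingPairs

/-!
# ω-census, family (b3): conjecture C9 (b) — a central commutator of order `4` gives box ratio `≥ 2`

HONEST FRAMING (pub-omega census; verbatim): lottery ticket; floor = certified bounds/negative ranges.
Census BOOKKEEPING (conjecture C9 of the cell, STRUCTURE.md §2; pub-omega kernel-l4 gen 15, task K-4 = the `p = 2` side of
`BoxBadOddPGroups`).  TYPE II-b of the minimal bad `2`-groups (a commutator of order `4` in the centre: `Heis 4` = SmallGroup(64,18),
SmallGroup(64,19) = `C4SqExt 2 2`, `C₁₆ ⋊₅ C₄` = SmallGroup(64,28), `C₃₂ ⋊₉ C₄`, …) is settled UNIFORMLY, like types I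
(`BoxBadCommutingPairs`) and II-a (`BoxBadTwoCommutators`):

**Theorem (`exists_indep_comm4`).** Let `g, h ∈ G` with `c = g h g⁻¹ h⁻¹` central, `c² ≠ 1`, `c⁴ = 1`.  With `K` a transversal of
`⟨c⟩` the `8|K| ≥ 2|G|` cells `(k,1,1)`, `(g⁻¹c²k,1,g)`, `(h⁻²c²k,1,h²)`, `(g⁻¹ck,g,1)`, `(g⁻²c³k,g,g)`, `(h⁻¹c³k,h,1)`, `(g⁻¹h⁻¹c²k,h,g)`,
`(h⁻³ck,h,h²)` (`k ∈ K`) of the box `G × {1, g, h} × {1, g, h²}` are independent (the `64` word equations close under one simp normal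
form: `g`-letters are moved left past `h`-letters at the cost of a power of `c`, `c` is fronted and reduced mod `c⁴`).  Found from
the seat's data: the finder reaches `2|G|` on this box for all three order-`64` groups of the type, and the universal `36`-vertex key
graph has an independent `8`-set with distinct columns (`q36c.py`); verified numerically on seven presentations of order `64` and on
`C₃₂ ⋊₉ C₄` (`verifyIIb2.py`).  **Corollary (`not_boxUseful_of_comm4`)**: such a finite group is not box-useful — in particular every
class-`2` group with a commutator of order exactly `4`.  Nothing here is progress on `ω`.
-/

namespace Summit.MatrixMultiplication.OmegaCensus

open Finset ProductBoxBound

namespace CommPairs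

variable {G : Type*} [Group G]

set_option maxHeartbeats 4000000 in
/-- **The uniform ratio-`2` witness for a central commutator `c = [g,h]` of order `4`.** [folklore] -/
theorem exists_indep_comm4 [Fintype G] [DecidableEq G] {g h c : G} (hgh : g * h * g⁻¹ * h⁻¹ = c)
    (hz : c ∈ Subgroup.center G) (hc2 : c * c ≠ 1) (hc4 : c * (c * (c * c)) = 1) :
    ∃ (Y W : Finset G) (J : Finset (G × G × G)), #Y = 3 ∧ #W = 3 ∧ J ⊆ univ ×ˢ (Y ×ˢ W) ∧
      (∀ P ∈ J, ∀ P' ∈ J, P ≠ P' → cellWord P P' ≠ 1) ∧ 2 * Fintype.card G ≤ #J := by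
  classical
  -- centrality and normalisation rules
  have cc : ∀ t : G, t * c = c * t := fun t => Subgroup.mem_center_iff.mp hz t
  have cl : ∀ x t : G, x * (c * t) = c * (x * t) := fun x t => by rw [← mul_assoc, cc x, mul_assoc]
  have q4 : ∀ t : G, c * (c * (c * (c * t))) = t := fun t => by
    calc c * (c * (c * (c * t))) = c * (c * (c * c)) * t := by group
      _ = t := by rw [hc4, one_mul]
  have i3 : c⁻¹ = c * (c * c) := by
    rw [inv_eq_iff_mul_eq_one, hc4]
  have cci : ∀ t : G, t * c⁻¹ = c⁻¹ * t := fun t => Subgroup.mem_center_iff.mp (Subgroup.inv_mem _ hz) t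
  have A : g * h = c * (h * g) := by
    calc g * h = g * h * g⁻¹ * h⁻¹ * (h * g) := by group
      _ = c * (h * g) := by rw [hgh]
  -- sorting rules: `g`-letters move left past `h`-letters
  have S1 : ∀ t : G, h * (g * t) = c⁻¹ * (g * (h * t)) := fun t => by
    have B : h * g = c⁻¹ * (g * h) := by rw [A, ← mul_assoc, inv_mul_cancel, one_mul]
    rw [← mul_assoc, B]; simp only [mul_assoc]
  have S2 : ∀ t : G, h * (g⁻¹ * t) = c * (g⁻¹ * (h * t)) := fun t => by
    have B : h * g⁻¹ = c * (g⁻¹ * h) := by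
      calc h * g⁻¹ = g⁻¹ * (g * h) * g⁻¹ := by group
        _ = g⁻¹ * (c * (h * g)) * g⁻¹ := by rw [A]
        _ = (g⁻¹ * c) * h := by group
        _ = (c * g⁻¹) * h := by rw [cc g⁻¹]
        _ = c * (g⁻¹ * h) := by group
    rw [← mul_assoc, B]; simp only [mul_assoc]
  have S3 : ∀ t : G, h⁻¹ * (g * t) = c * (g * (h⁻¹ * t)) := fun t => by
    have B : h⁻¹ * g = c * (g * h⁻¹) := by
      calc h⁻¹ * g = h⁻¹ * (g * h) * h⁻¹ := by group
        _ = h⁻¹ * (c * (h * g)) * h⁻¹ := by rw [A]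
        _ = (h⁻¹ * c) * h * g * h⁻¹ := by group
        _ = (c * h⁻¹) * h * g * h⁻¹ := by rw [cc h⁻¹]
        _ = c * (g * h⁻¹) := by group
    rw [← mul_assoc, B]; simp only [mul_assoc]
  have S4 : ∀ t : G, h⁻¹ * (g⁻¹ * t) = c⁻¹ * (g⁻¹ * (h⁻¹ * t)) := fun t => by
    have B : h⁻¹ * g⁻¹ = c⁻¹ * (g⁻¹ * h⁻¹) := by
      calc h⁻¹ * g⁻¹ = (g * h)⁻¹ := by group
        _ = (c * (h * g))⁻¹ := by rw [A]
        _ = (g⁻¹ * h⁻¹) * c⁻¹ := by group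
        _ = c⁻¹ * (g⁻¹ * h⁻¹) := by rw [cci]
    rw [← mul_assoc, B]; simp only [mul_assoc]
  -- the commutator with `h²`
  have A2 : g * (h * h) * g⁻¹ * (h * h)⁻¹ = c * c := by
    have e1 : g * (h * h) * g⁻¹ = (g * h * g⁻¹) * (g * h * g⁻¹) := by group
    have e2 : g * h * g⁻¹ = c * h := by rw [← hgh]; group
    rw [e1, e2]
    calc c * h * (c * h) * (h * h)⁻¹ = c * (h * c) * h * (h * h)⁻¹ := by group
      _ = c * (c * h) * h * (h * h)⁻¹ := by rw [cc h]
      _ = c * c := by group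
  -- distinctness
  have hc1 : c ≠ 1 := by rintro rfl; exact hc2 (one_mul 1)
  have hg1 : g ≠ 1 := by rintro rfl; apply hc1; rw [← hgh]; group
  have hh1 : h ≠ 1 := by rintro rfl; apply hc1; rw [← hgh]; group
  have hgh' : g ≠ h := by rintro rfl; apply hc1; rw [← hgh]; group
  have hhh : h * h ≠ 1 := by intro e; apply hc2; rw [← A2, e]; group
  have hghh : g ≠ h * h := by intro e; apply hc1; rw [← hgh, e]; group
  -- the subgroup `⟨c⟩` and a transversal
  set N : Subgroup G := Subgroup.zpowers c with hN
  have cardN : Nat.card N ≤ 4 := by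
    rw [hN, Nat.card_zpowers]
    exact orderOf_le_of_pow_eq_one (by norm_num) (by
      calc c ^ 4 = c * (c * (c * c)) := by simp only [pow_succ, pow_zero, one_mul, mul_assoc]
        _ = 1 := hc4)
  obtain ⟨Rset, hR, -⟩ := N.exists_isComplement_right 1
  have hRfin : Rset.Finite := Set.toFinite Rset
  set K : Finset G := hRfin.toFinset with hKdef
  have memK : ∀ r, r ∈ K ↔ r ∈ Rset := fun r => Set.Finite.mem_toFinset hRfin
  have cardK : Fintype.card G ≤ 4 * #K := by
    have e1 : #K = N.index := by rw [hKdef, ← hR.ncard_right, Set.ncard_eq_toFinset_card Rset hRfin]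
    have e2 : Nat.card N * N.index = Nat.card G := N.card_mul_index
    rw [← Nat.card_eq_fintype_card, ← e2, e1]
    exact Nat.mul_le_mul_right _ cardN
  have noN : ∀ n : G, n ∈ N → n ≠ 1 → ∀ b ∈ K, ∀ b' ∈ K, n * b ≠ b' := by
    intro n hn hn1 b hb b' hb' e
    have := @hR.1 (⟨n, hn⟩, ⟨b, (memK b).1 hb⟩) (⟨1, N.one_mem⟩, ⟨b', (memK b').1 hb'⟩) (by simpa using e)
    simp only [Prod.mk.injEq, Subtype.mk.injEq] at this
    exact hn1 this.1
  have memc : ∀ j : ℕ, c ^ j ∈ N := fun j => by rw [hN]; exact Subgroup.pow_mem _ (Subgroup.mem_zpowers c) j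
  have hc3 : c * (c * c) ≠ 1 := by
    intro e; apply hc1
    calc c = c * (c * (c * c)) * (c * (c * c))⁻¹ := by group
      _ = 1 := by rw [hc4, e]; group
  have no1 : ∀ b ∈ K, ∀ b' ∈ K, c * b ≠ b' := noN c (by simpa using memc 1) hc1
  have no2 : ∀ b ∈ K, ∀ b' ∈ K, c * (c * b) ≠ b' := fun b hb b' hb' e =>
    noN (c * c) (by simpa [pow_two] using memc 2) hc2 b hb b' hb' (by rw [mul_assoc]; exact e)
  have no3 : ∀ b ∈ K, ∀ b' ∈ K, c * (c * (c * b)) ≠ b' := fun b hb b' hb' e =>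
    noN (c * (c * c)) (by simpa [pow_succ, mul_assoc] using memc 3) hc3 b hb b' hb' (by simp only [mul_assoc]; exact e)
  -- the eight parts, indexed by `Fin 8`
  let U : Fin 8 → G × G × G := fun i => match i with
    | ⟨0, _⟩ => (1, 1, 1)
    | ⟨1, _⟩ => (g⁻¹ * (c * c), 1, g)
    | ⟨2, _⟩ => (h⁻¹ * h⁻¹ * (c * c), 1, h * h)
    | ⟨3, _⟩ => (g⁻¹ * c, g, 1)
    | ⟨4, _⟩ => (g⁻¹ * g⁻¹ * (c * (c * c)), g, g)
    | ⟨5, _⟩ => (h⁻¹ * (c * (c * c)), h, 1)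
    | ⟨6, _⟩ => (g⁻¹ * h⁻¹ * (c * c), h, g)
    | ⟨7, _⟩ => (h⁻¹ * h⁻¹ * h⁻¹ * c, h, h * h)
    | ⟨n + 8, hn⟩ => absurd hn (by omega)
  let f : G × Fin 8 → G × G × G := fun p => ((U p.2).1 * p.1, (U p.2).2.1, (U p.2).2.2)
  have finj : Set.InjOn f ↑(K ×ˢ (Finset.univ : Finset (Fin 8))) := by
    rintro ⟨k, i⟩ - ⟨k', i'⟩ - e
    have e23 : (U i).2 = (U i').2 := by
      have h2 := congrArg (fun P : G × G × G => P.2) e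
      simpa [f] using h2
    have hii : i = i' := by
      fin_cases i <;> fin_cases i' <;>
        simp [U, hg1, hh1, hgh', hhh, hghh, hg1.symm, hh1.symm, hgh'.symm, hhh.symm, hghh.symm] at e23 ⊢
    subst hii
    have e1 : (U i).1 * k = (U i).1 * k' := congrArg Prod.fst e
    rw [mul_left_cancel e1]
  set J : Finset (G × G × G) := (K ×ˢ (Finset.univ : Finset (Fin 8))).image f with hJ
  have cardJ : #J = #K * 8 := by
    rw [hJ, Finset.card_image_of_injOn finj, Finset.card_product, Finset.card_univ, Fintype.card_fin]
  have memJ : ∀ {P : G × G × G}, P ∈ J → ∃ k ∈ K, ∃ i : Fin 8, P = ((U i).1 * k, (U i).2.1, (U i).2.2) := by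
    intro P hP
    obtain ⟨⟨k, i⟩, hki, rfl⟩ := Finset.mem_image.1 hP
    exact ⟨k, (Finset.mem_product.1 hki).1, i, rfl⟩
  refine ⟨{1, g, h}, {1, g, h * h}, J, ?_, ?_, ?_, ?_, ?_⟩
  · rw [card_insert_of_notMem (by simp [hg1.symm, hh1.symm]), card_insert_of_notMem (by simpa using hgh'), card_singleton]
  · rw [card_insert_of_notMem (by simp [hg1.symm, hhh.symm]), card_insert_of_notMem (by simpa using hghh), card_singleton]
  · intro P hP
    obtain ⟨k, -, i, rfl⟩ := memJ hP
    simp only [mem_product, mem_univ, true_and, mem_insert, mem_singleton]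
    fin_cases i <;> simp [U]
  · -- independence: 64 cases, one normalisation
    intro P hP P' hP' hne hw
    obtain ⟨k, hk, i, rfl⟩ := memJ hP
    obtain ⟨k', hk', i', rfl⟩ := memJ hP'
    fin_cases i <;> fin_cases i' <;> simp only [U, cellWord] at hw hne <;> have e := solve_left hw <;>
      simp only [mul_assoc, mul_inv_rev, inv_inv, inv_one, one_mul, mul_one, S1, S2, S3, S4, i3, q4,
        cl g, cl g⁻¹, cl h, cl h⁻¹, mul_inv_cancel_left, inv_mul_cancel_left] at e <;>
      first
        | exact (no1 k' hk' k hk e.symm).elim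
        | exact (no2 k' hk' k hk e.symm).elim
        | exact (no3 k' hk' k hk e.symm).elim
        | (apply hne; rw [e])
  · rw [cardJ]; omega

/-- **A finite group with a central commutator `[g,h]` of order `4` is NOT box-useful.** [folklore] -/
theorem not_boxUseful_of_comm4 [Fintype G] [DecidableEq G] {g h c : G} (hgh : g * h * g⁻¹ * h⁻¹ = c)
    (hz : c ∈ Subgroup.center G) (hc2 : c * c ≠ 1) (hc4 : c * (c * (c * c)) = 1) : ¬ BoxUseful G := by
  obtain ⟨Y, W, J, hY, hW, hJ, hind, hcard⟩ := exists_indep_comm4 hgh hz hc2 hc4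
  exact not_boxUseful_of_indep hY hW hJ hind (by omega)

end CommPairs

end Summit.MatrixMultiplication.OmegaCensus
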